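import Summits.AnomalousDissipation.AnomalousDissipation.Theorems.KolmogorovFloorEnsembleCeiling.Negative.DodgerStates
import Summits.AnomalousDissipation.AnomalousDissipation.Theorems.KolmogorovFloorEnsembleCeiling.Negative.DodgerStrain
import Summits.AnomalousDissipation.AnomalousDissipation.Theorems.KolmogorovFloorEnsembleCeiling.Negative.DodgerTools

/-!
# The sign-averaged floor at a dressed dodger (negative side of `KolmogorovFloorEnsembleCeiling`,
# stmt-AnomalousDissipation-14183), part 2/3

Line lead `prover-line-stmt-AnomalousDissipation-14183-0` (2026-08-16). The analytic core of the truncated-dodger kill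
(card `truncated-euler-k41-hot`): test the floor at the two states `a ± t ŵ` — `a` a truncated dodger at level `n`,
`ŵ` the strain-punishing packet of `PacketLemma` above level `2n` riding the most compressive direction of the
multiplier's derivative (`DodgerStrain.exists_strain_sup_compressive`), `t² = τ = 51ν√‖∇a‖² + ν²`. Averaging over the
sign kills every odd term, the first lemma kills injection + inertia + work, Young's inequality prices the viscous
drift `ν(a, ΔW)` against the Korn-type bound `‖∇W‖₂² ≤ 162 s²`, and the packet's stress `≤ −s/4` pays for it:

* `floor_sum_at_dodger` — `2ε₀ ≤ (4B+1)·ν‖∇a‖² + 4B·ν·τ·‖∇ŵ‖²`, `B = 1 + 2Θ`, from the two floor inequalities;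
* `floor_sum_at_level` — the same with the packet produced from the packet lemma at level `n` and Bernstein's
  bound `‖∇ŵ‖² ≤ 4π²(K₁n)²`, given room `2∫‖a‖² + 2τ ≤ 16‖f‖²/ν²` in the Leray ball.

Nothing here asserts a Theses statement.
-/


noncomputable section

open MeasureTheory UnitAddTorus
open scoped InnerProductSpace ENNReal

namespace Summit.AnomalousDissipation.AnomalousDissipation.Theorems.KolmogorovFloorEnsembleCeiling.Negative

open Literature.Analysis.FunctionSpaces Literature.Analysis.FunctionSpaces.Torus Literature.Analysis.FluidPDE
open Summit.AnomalousDissipation.AnomalousDissipation.Theses.TaylorCertificates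
open Summit.AnomalousDissipation.AnomalousDissipation.Theorems.TaylorCertificatePair.Negative

/-! ## The sign-averaged floor -/


/-- **The sign-averaged floor at a dodger dressed with an invisible packet.** Data: a smooth force `f`, a
truncated dodger `a` at level `n`, a cylindrical `Φ₁` whose differential at the dodger's state is the smooth
solenoidal mean-zero multiplier `W` (band-limited at level `n`, strain form bounded by `s ≥ 0`), a smooth
solenoidal mean-zero packet `w` of unit energy, invisible to `Φ₁` (the states of `a ± t w` have differential `W`)
and compressive (`∫⟪DW·w, w⟫ ≤ −s/4`), the amplitude `t² = τ = 51ν√‖∇a‖² + ν²`, and the floor inequality at the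
two states `a ± t w` (inside the Leray ball). Conclusion: `2ε₀ ≤ (4B+1)·ν‖∇a‖² + 4B·ν·τ·‖∇w‖²`, `B = 1 + 2Θ`. -/
theorem floor_sum_at_dodger {n : ℕ} {f a W w : UnitAddTorus (Fin 3) → EuclideanSpace ℝ (Fin 3)} (hf : IsSmooth f)
    (ha : IsTruncatedEulerSteady n f a) (hWs : IsSmooth W) (hWd : IsDivFree W) (hWz : HasZeroMean W)
    (hWb : fourierTruncate n W = W) {s : ℝ} (hs0 : 0 ≤ s)
    (hsb : ∀ (z : UnitAddTorus (Fin 3)) (η : EuclideanSpace ℝ (Fin 3)), ‖η‖ = 1 → |⟪η, Torus.fderiv W z η⟫_ℝ| ≤ s)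
    (hws : IsSmooth w) (hIw : ∫ z, ⟪Torus.fderiv W z (w z), w z⟫_ℝ ≤ -(s / 4))
    {ν ε₀ Θ θ₁ τ t : ℝ} (hν : 0 < ν) (hΘ1 : -Θ ≤ θ₁) (hθ1 : θ₁ ≤ 0)
    (hτdef : τ = 51 * ν * Real.sqrt (gradNormSq a) + ν ^ 2) (ht2 : t ^ 2 = τ)
    {Φ₁ : Torus.CylindricalTest (Fin 3)} {Up Um : Torus.energySpace (Fin 3)}
    (hUp : ((Up : Lp (EuclideanSpace ℝ (Fin 3)) 2 (volume : Measure (UnitAddTorus (Fin 3)))) :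
      UnitAddTorus (Fin 3) → EuclideanSpace ℝ (Fin 3)) =ᵐ[volume] (a + t • w))
    (hUm : ((Um : Lp (EuclideanSpace ℝ (Fin 3)) 2 (volume : Measure (UnitAddTorus (Fin 3)))) :
      UnitAddTorus (Fin 3) → EuclideanSpace ℝ (Fin 3)) =ᵐ[volume] (a + (-t) • w))
    (hgradp : Φ₁.grad Up = W) (hgradm : Φ₁.grad Um = W)
    (hflUp : FloorIneqAt ν f Φ₁ θ₁ ε₀ Up) (hflUm : FloorIneqAt ν f Φ₁ θ₁ ε₀ Um)
    (hballp : ∫ z, ‖(a + t • w) z‖ ^ 2 ≤ 16 * (∫ z, ‖f z‖ ^ 2) / ν ^ 2)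
    (hballm : ∫ z, ‖(a + (-t) • w) z‖ ^ 2 ≤ 16 * (∫ z, ‖f z‖ ^ 2) / ν ^ 2) :
    2 * ε₀ ≤ (4 * (1 + 2 * Θ) + 1) * (ν * gradNormSq a) + 4 * (1 + 2 * Θ) * ν * τ * gradNormSq w := by
  have hacopy := ha
  obtain ⟨has, had, haz, hab, -⟩ := hacopy
  have hps : IsSmooth (a + t • w) := has.add (hws.smul t)
  have hms : IsSmooth (a + (-t) • w) := has.add (hws.smul (-t))
  -- first lemma
  obtain ⟨hcancel, hwork⟩ := dodger_identities hf ha hWs hWd hWz hWb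
  -- Korn
  have hEW : gradNormSq W ≤ 162 * s ^ 2 := by
    have h := gradNormSq_le_of_strain_bound hWs hWd hsb
    simp only [Fintype.card_fin] at h
    norm_num at h
    linarith
  set Ea : ℝ := gradNormSq a with hEadef
  have hEa0 : 0 ≤ Ea := gradNormSq_nonneg a
  have hτ : 0 < τ := by
    have : 0 ≤ 51 * ν * Real.sqrt Ea := by positivity
    have : 0 < ν ^ 2 := by positivity
    linarith
  -- the floor at the two states, on representatives
  have hflp := floorIneq_at_rep hps hUp hflUp hballp
  have hflm := floorIneq_at_rep hms hUm hflUm hballm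
  rw [hgradp] at hflp
  rw [hgradm] at hflm
  -- sign averaging
  have hlin1 := linear_sum_pm (a := a) (w := w) (g := laplacian W) has.continuous hws.continuous
    hWs.laplacian.continuous t
  have hlin2 := linear_sum_pm (a := a) (w := w) (g := f) has.continuous hws.continuous hf.continuous t
  have hin := inertial_sum_pm (W := W) has hws hWs t
  have hgp := gradNormSq_add_smul_le has hws t
  have hgm := gradNormSq_add_smul_le has hws (-t)
  rw [neg_sq] at hgm
  set B : ℝ := 1 + 2 * Θ with hBdef
  have h12θ : 0 ≤ 1 - 2 * θ₁ := by linarith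
  have h12θB : 1 - 2 * θ₁ ≤ B := by rw [hBdef]; linarith
  have hB1 : 1 ≤ B := by rw [hBdef]; linarith
  have hsum : 2 * ε₀ ≤ (1 - 2 * θ₁) * (ν * (gradNormSq (a + t • w) + gradNormSq (a + (-t) • w))) +
      2 * (ν * ∫ z, ⟪a z, laplacian W z⟫_ℝ) + 2 * t ^ 2 * ∫ z, ⟪Torus.fderiv W z (w z), w z⟫_ℝ := by
    set Gp := gradNormSq (a + t • w) with hGp
    set Gm := gradNormSq (a + (-t) • w) with hGm
    set Lp := ∫ z, ⟪(a + t • w) z, laplacian W z⟫_ℝ with hLp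
    set Lm := ∫ z, ⟪(a + (-t) • w) z, laplacian W z⟫_ℝ with hLm
    set Pp := ∫ z, ⟪(a + t • w) z, f z⟫_ℝ with hPp
    set Pm := ∫ z, ⟪(a + (-t) • w) z, f z⟫_ℝ with hPm
    set Ip := ∫ z, ⟪Torus.fderiv W z ((a + t • w) z), (a + t • w) z⟫_ℝ with hIp
    set Im := ∫ z, ⟪Torus.fderiv W z ((a + (-t) • w) z), (a + (-t) • w) z⟫_ℝ with hIm
    set A := ∫ z, ⟪a z, laplacian W z⟫_ℝ with hA
    set Pa := ∫ z, ⟪a z, f z⟫_ℝ with hPa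
    set Ia := ∫ z, ⟪Torus.fderiv W z (a z), a z⟫_ℝ with hIa
    set Iw := ∫ z, ⟪Torus.fderiv W z (w z), w z⟫_ℝ with hIw0
    set FW := ∫ z, ⟪f z, W z⟫_ℝ with hFW
    have e1 : (1 - 2 * θ₁) * (ν * Gp) + (1 - 2 * θ₁) * (ν * Gm) = (1 - 2 * θ₁) * (ν * (Gp + Gm)) := by ring
    have e2 : ν * Lp + ν * Lm = 2 * (ν * A) := by rw [← mul_add, hlin1]; ring
    have e3 : 2 * θ₁ * Pp + 2 * θ₁ * Pm = 0 := by
      rw [show 2 * θ₁ * Pp + 2 * θ₁ * Pm = 2 * θ₁ * (Pp + Pm) by ring, hlin2, hwork]; ring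
    linarith [hflp, hflm, e1, e2, e3, hin, hcancel]
  have hgrad : (1 - 2 * θ₁) * (ν * (gradNormSq (a + t • w) + gradNormSq (a + (-t) • w))) ≤
      B * (ν * (4 * Ea + 4 * τ * gradNormSq w)) := by
    have h1 : gradNormSq (a + t • w) + gradNormSq (a + (-t) • w) ≤ 4 * Ea + 4 * τ * gradNormSq w := by
      rw [ht2] at hgp hgm
      linarith
    have h2 : 0 ≤ ν * (gradNormSq (a + t • w) + gradNormSq (a + (-t) • w)) :=
      mul_nonneg hν.le (add_nonneg (gradNormSq_nonneg _) (gradNormSq_nonneg _))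
    calc (1 - 2 * θ₁) * (ν * (gradNormSq (a + t • w) + gradNormSq (a + (-t) • w)))
        ≤ B * (ν * (gradNormSq (a + t • w) + gradNormSq (a + (-t) • w))) :=
          mul_le_mul_of_nonneg_right h12θB h2
      _ ≤ B * (ν * (4 * Ea + 4 * τ * gradNormSq w)) := by
          refine mul_le_mul_of_nonneg_left (mul_le_mul_of_nonneg_left h1 hν.le) (by linarith)
  -- the drift against the packet: `2ν (a, ΔW) + 2τ I(w) ≤ ν ‖∇a‖²`
  have hdrift : 2 * (ν * ∫ z, ⟪a z, laplacian W z⟫_ℝ) + 2 * t ^ 2 * ∫ z, ⟪Torus.fderiv W z (w z), w z⟫_ℝ ≤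
      ν * Ea := by
    rw [ht2]
    have habs := le_abs_self (∫ z, ⟪a z, laplacian W z⟫_ℝ)
    rcases eq_or_lt_of_le hs0 with hs | hs
    · -- `s = 0`: `W` is enstrophy-free, Young with `λ = 1`
      have hY := two_mul_abs_integral_inner_laplacian_le has hWs one_pos
      have hEW0 : gradNormSq W = 0 := by
        refine le_antisymm ?_ (gradNormSq_nonneg W)
        rw [← hs] at hEW
        simpa using hEW
      rw [hEW0, zero_div, add_zero, one_mul] at hY
      have hI0 : ∫ z, ⟪Torus.fderiv W z (w z), w z⟫_ℝ ≤ 0 := by rw [← hs] at hIw; simpa using hIw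
      have h1 := mul_le_mul_of_nonneg_left hY hν.le
      have h2 := mul_le_mul_of_nonneg_left habs hν.le
      have h3 : τ * ∫ z, ⟪Torus.fderiv W z (w z), w z⟫_ℝ ≤ 0 := mul_nonpos_of_nonneg_of_nonpos hτ.le hI0
      linarith [h1, h2, h3]
    · -- `s > 0`: Young with `λ = 648 ν s / τ`
      have hlam : 0 < 648 * ν * s / τ := by positivity
      have hY := two_mul_abs_integral_inner_laplacian_le has hWs hlam
      have h1 : gradNormSq W / (648 * ν * s / τ) ≤ 162 * s ^ 2 / (648 * ν * s / τ) :=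
        div_le_div_of_nonneg_right hEW hlam.le
      have hsimp : 162 * s ^ 2 / (648 * ν * s / τ) = s * τ / (4 * ν) := by
        field_simp
        ring
      have hY' : 2 * |∫ z, ⟪a z, laplacian W z⟫_ℝ| ≤ 648 * ν * s / τ * Ea + s * τ / (4 * ν) := by
        rw [← hsimp]; linarith
      have hτ2 : 2592 * ν ^ 2 * Ea ≤ τ ^ 2 := by
        have h1 : 51 * ν * Real.sqrt Ea ≤ τ := by rw [hτdef]; linarith [sq_nonneg ν]
        have h2 : (51 * ν * Real.sqrt Ea) ^ 2 ≤ τ ^ 2 := pow_le_pow_left₀ (by positivity) h1 2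
        rw [mul_pow, mul_pow, Real.sq_sqrt hEa0] at h2
        norm_num at h2
        linarith [h2, mul_nonneg (sq_nonneg ν) hEa0]
      -- multiply Young by `ν`: `2ν|(a,ΔW)| ≤ 648 ν² s Ea/τ + sτ/4 ≤ sτ/4 + sτ/4`
      have hkey : ν * (648 * ν * s / τ * Ea) ≤ s * τ / 4 := by
        rw [show ν * (648 * ν * s / τ * Ea) = s * (648 * ν ^ 2 * Ea) / τ by ring, div_le_iff₀ hτ]
        have h := mul_le_mul_of_nonneg_left hτ2 (by positivity : (0 : ℝ) ≤ s / 4)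
        linarith [h]
      have hνY : 2 * (ν * |∫ z, ⟪a z, laplacian W z⟫_ℝ|) ≤ ν * (648 * ν * s / τ * Ea) + ν * (s * τ / (4 * ν)) := by
        have h := mul_le_mul_of_nonneg_left hY' hν.le
        linarith [h]
      have hcancelν : ν * (s * τ / (4 * ν)) = s * τ / 4 := by field_simp
      rw [hcancelν] at hνY
      have hpacket : 2 * τ * ∫ z, ⟪Torus.fderiv W z (w z), w z⟫_ℝ ≤ -(s * τ / 2) := by
        have h := mul_le_mul_of_nonneg_left hIw (by positivity : (0 : ℝ) ≤ 2 * τ)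
        linarith [h]
      have hmono : ν * ∫ z, ⟪a z, laplacian W z⟫_ℝ ≤ ν * |∫ z, ⟪a z, laplacian W z⟫_ℝ| :=
        mul_le_mul_of_nonneg_left habs hν.le
      linarith [hνY, hkey, hpacket, hmono, mul_nonneg hν.le hEa0]
  linarith [hsum, hgrad, hdrift]

/-- **The dressed dodger at one level.** Given the force, a dodger `a` at level `n ≥ 1`, a band-limited certificate
`(N ≤ n, Φ₁, θ₁ ∈ [−Θ, 0])` valid at every state (the body of `KolmogorovFloorDatumAt` at viscosity `ν`), the packet lemma
at level `n` with constant `K₁`, and room in the Leray ball (`2∫‖a‖² + 2τ ≤ 16‖f‖²/ν²`): the sign-averaged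
floor gives `2ε₀ ≤ (4B+1) ν ‖∇a‖² + 4B ν τ · 4π² (K₁ n)²`. -/
theorem floor_sum_at_level {n N K₁ : ℕ} (hn1 : 1 ≤ n) (hNn : N ≤ n)
    {f a : UnitAddTorus (Fin 3) → EuclideanSpace ℝ (Fin 3)} (hf : IsSmooth f) (ha : IsTruncatedEulerSteady n f a)
    (hK₁ : ∀ W : UnitAddTorus (Fin 3) → EuclideanSpace ℝ (Fin 3), IsSmooth W → IsDivFree W → fourierTruncate n W = W →
      ∀ s : ℝ, (∀ (x : UnitAddTorus (Fin 3)) (η : EuclideanSpace ℝ (Fin 3)), ‖η‖ = 1 →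
        |⟪η, convect (fun _ => η) W x⟫_ℝ| ≤ s) →
      ∀ (x₀ : UnitAddTorus (Fin 3)) (ξ : EuclideanSpace ℝ (Fin 3)), ‖ξ‖ = 1 →
        ∃ w : UnitAddTorus (Fin 3) → EuclideanSpace ℝ (Fin 3), IsSmooth w ∧ IsDivFree w ∧ HasZeroMean w ∧
          fourierTruncate (2 * n) w = 0 ∧ fourierTruncate (K₁ * n) w = w ∧ ∫ x, ‖w x‖ ^ 2 = 1 ∧
            ∫ x, ⟪w x, convect w W x⟫_ℝ ≤ ⟪ξ, convect (fun _ => ξ) W x₀⟫_ℝ + s / 4)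
    {ν ε₀ Θ θ₁ τ : ℝ} (hν : 0 < ν) (hΘ1 : -Θ ≤ θ₁) (hθ1 : θ₁ ≤ 0)
    (hτdef : τ = 51 * ν * Real.sqrt (gradNormSq a) + ν ^ 2)
    {Φ₁ : Torus.CylindricalTest (Fin 3)} (hband : ∀ i, fourierTruncate N (Φ₁.g i) = Φ₁.g i)
    (hu : ∀ u : Torus.energySpace (Fin 3), FloorIneqAt ν f Φ₁ θ₁ ε₀ u)
    (hroom : 2 * (∫ z, ‖a z‖ ^ 2) + 2 * τ ≤ 16 * (∫ z, ‖f z‖ ^ 2) / ν ^ 2) :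
    2 * ε₀ ≤ (4 * (1 + 2 * Θ) + 1) * (ν * gradNormSq a) +
      4 * (1 + 2 * Θ) * ν * τ * (4 * Real.pi ^ 2 * ((K₁ * n : ℕ) : ℝ) ^ 2) := by
  have ha' := ha
  obtain ⟨has, had, haz, hab, -⟩ := ha'
  obtain ⟨Ua, hUa⟩ := exists_state_of_smooth has had haz
  set W := Φ₁.grad Ua with hWdef
  have hWs : IsSmooth W := isSmooth_grad Φ₁ Ua
  have hWd : IsDivFree W := isDivFree_grad Φ₁ Ua
  have hWz : HasZeroMean W := hasZeroMean_grad Φ₁ Ua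
  have hWcoef : ∀ κ, ((n : ℕ) : ℝ) ^ 2 < freqNormSq κ → mFourierCoeff (EuclideanSpace.complexify ∘ W) κ = 0 := by
    intro κ hκ
    refine fc_grad_eq_zero Φ₁ hband Ua κ (lt_of_le_of_lt ?_ hκ)
    exact_mod_cast Nat.pow_le_pow_left hNn 2
  have hWb : fourierTruncate n W = W := fourierTruncate_eq_self hWs.continuous hWcoef
  -- strain sup and compressive direction
  obtain ⟨s, hs0, hsb, x₀, ξ, hξ, hcomp⟩ := exists_strain_sup_compressive hWs hWd
  -- the packet
  obtain ⟨w, hws, hwd, hwz, hw0, hwK, hw1, hIw⟩ := hK₁ W hWs hWd hWb s (fun z η hη => hsb z η hη) x₀ ξ hξ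
  have hEw : gradNormSq w ≤ 4 * Real.pi ^ 2 * ((K₁ * n : ℕ) : ℝ) ^ 2 := by
    have h := gradNormSq_le_of_fourierTruncate_eq_self hws hwK
    rw [hw1, mul_one] at h
    exact h
  have hIw' : ∫ z, ⟪Torus.fderiv W z (w z), w z⟫_ℝ ≤ -(s / 4) := by
    have e : ∫ z, ⟪Torus.fderiv W z (w z), w z⟫_ℝ = ∫ z, ⟪w z, convect w W z⟫_ℝ :=
      integral_congr_ae (ae_of_all _ fun z => real_inner_comm _ _)
    rw [e]
    have hc : ⟪ξ, convect (fun _ => ξ) W x₀⟫_ℝ ≤ -(s / 2) := hcomp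
    linarith
  -- amplitude and states
  have hEa0 : 0 ≤ gradNormSq a := gradNormSq_nonneg a
  have hτ : 0 < τ := by
    have : 0 ≤ 51 * ν * Real.sqrt (gradNormSq a) := by positivity
    have : 0 < ν ^ 2 := by positivity
    linarith
  set t : ℝ := Real.sqrt τ with htdef
  have ht2 : t ^ 2 = τ := Real.sq_sqrt hτ.le
  obtain ⟨hps, hpd, hpz⟩ := testState_regular has had haz hws hwd hwz t
  obtain ⟨hms, hmd, hmz⟩ := testState_regular has had haz hws hwd hwz (-t)
  obtain ⟨Up, hUp⟩ := exists_state_of_smooth hps hpd hpz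
  obtain ⟨Um, hUm⟩ := exists_state_of_smooth hms hmd hmz
  -- the packet is invisible to the certificate
  have hwg : ∀ i, ∫ z, ⟪w z, Φ₁.g i z⟫_ℝ = 0 := by
    intro i
    exact integral_inner_eq_zero_of_band_gap hws.continuous (Φ₁.g_smooth i).continuous
      (show N ≤ 2 * n by omega) hw0 fun κ hκ => fc_g_eq_zero Φ₁ hband i κ hκ
  have hcoords : ∀ {s' : ℝ} {U : Torus.energySpace (Fin 3)},
      (((U : Lp (EuclideanSpace ℝ (Fin 3)) 2 (volume : Measure (UnitAddTorus (Fin 3)))) :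
        UnitAddTorus (Fin 3) → EuclideanSpace ℝ (Fin 3)) =ᵐ[volume] (a + s' • w)) → Φ₁.grad U = W := by
    intro s' U hU
    apply grad_eq_of_coords_eq
    ext i
    rw [coords_of_ae hU, coords_of_ae hUa, integral_inner_add_smul has.continuous hws.continuous
      (Φ₁.g_smooth i).continuous, hwg i, mul_zero, add_zero]
  have hgradp : Φ₁.grad Up = W := hcoords hUp
  have hgradm : Φ₁.grad Um = W := hcoords hUm
  -- the Leray ball
  have hball : ∀ s' : ℝ, s' ^ 2 = τ → ∫ z, ‖(a + s' • w) z‖ ^ 2 ≤ 16 * (∫ z, ‖f z‖ ^ 2) / ν ^ 2 := by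
    intro s' hs'
    have h1 := integral_norm_sq_add_smul_le has.continuous hws.continuous s'
    rw [hw1, mul_one, hs'] at h1
    linarith
  have hnegt : (-t) ^ 2 = τ := by rw [neg_sq]; exact ht2
  have hmain := floor_sum_at_dodger hf ha hWs hWd hWz hWb hs0 hsb hws hIw' hν hΘ1 hθ1 hτdef ht2 hUp hUm
    hgradp hgradm (hu Up) (hu Um) (hball t ht2) (hball (-t) hnegt)
  have hcoef : 0 ≤ 4 * (1 + 2 * Θ) * ν * τ := by
    have hΘ : 0 ≤ 1 + 2 * Θ := by linarith
    positivity
  linarith [hmain, mul_le_mul_of_nonneg_left hEw hcoef]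


end Summit.AnomalousDissipation.AnomalousDissipation.Theorems.KolmogorovFloorEnsembleCeiling.Negative
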